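import Summits.KontsevichZagierPeriods.KontsevichZagierPeriods.Theorems.HurwitzMicroSectorsNormalFormPrinciplePiBoxTransfer

/-!
# Crux `NormalFormPrinciple` (stmt-KontsevichZagierPeriods-3869) — line `SketchIdeator1`
# ("π buys geometry"): the SKELETON, v3 (lead seat c2, 2026-08-16)

Everything the line can prove is LANDED in the tree and imported from
`Theorems/HurwitzMicroSectorsNormalFormPrinciplePiBoxTransfer.lean` (p94864, p97329) and its stub
files (`…StubVolumePiBox` p94614, `…StubBoxPiStable` p87289, `…StubBoxCombine` p86896,
`…StubPiCalibration` p88311, `…StubSignPresentation` p86549, `…StubSignKernelRep` p86774,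
`…StubSignKernelSplit` p87131; sub-goals p88524, p89208):

* `exists_boxRat_piPow_sub` (**PiBoxReduction**, unconditional): every representation `r` has
  `k`, `m` and a box-rational `N` on `(0,1)ᵐ` with `[π]^k·[r] − [N] ∈ KZ.relations`;
* `statement_iff_leaves : KontsevichZagierPeriods ↔ BoxRigidity ∧ KZ.PiCancellation`;
* `normalFormPrinciple_of_leaves : BoxRigidity → KZ.PiCancellation → NormalFormPrinciple`.

What remains are the line's two registered conjecture-grade stubs, its declared residual `C⁺`:
`stub_boxRigidity` (Conjecture 1 of Kontsevich–Zagier with the domain frozen to open unit boxes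
and the integrand to KZ's rational shape) and `stub_piCancellation` (`= KZ.PiCancellation`, item
stmt-KontsevichZagierPeriods-0540). Jointly they are EXACTLY summit-strength
(`statement_iff_leaves` with the route's `closes`), so no move-level content is left in the line.
Sources: M. Kontsevich, D. Zagier, *Periods* (2001), §1.2 Conjecture 1, §4.1.
-/

noncomputable section

open MeasureTheory Set
open Literature.NumberTheory.Transcendental Literature.NumberTheory.Transcendental.KZ

namespace Summit.KontsevichZagierPeriods.HurwitzMicroSectors.NormalFormPrinciple.PiBox

open Summit.KontsevichZagierPeriods.KontsevichZagierPeriods.Theses.HurwitzMicroSectors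
  (NormalFormPrinciple)

/-! ## The two conjecture-grade stubs (the line's declared residual `C⁺`) -/

/-- **Stub `stub_boxRigidity` (BoxRigidity; conjecture-grade, summit-implied).** Two
representations on open unit boxes `(0,1)ᵐ`, `(0,1)ᵐ'` with integrands of KZ's rational shape
(`p/q`, `q ≠ 0` on the box) and equal values are KZ-equivalent. Conjecture 1 of
[Kontsevich–Zagier 2001, §1.2] with the geometry frozen; OPEN (summit ⇒ this ⇒ `KZ.PiLocalKernel`,
`leaves_of_statement` / `piLocalKernel_of_boxRigidity`). -/
theorem stub_boxRigidity :
    ∀ (m m' : ℕ) (N : IntegralRep m) (N' : IntegralRep m'),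
      N.domain = {x | ∀ i, x i ∈ Set.Ioo (0:ℝ) 1} → N.IsRational →
      N'.domain = {x | ∀ i, x i ∈ Set.Ioo (0:ℝ) 1} → N'.IsRational →
      N.value = N'.value → Equivalent N N' := by
  sorry

/-- **Stub `stub_piCancellation` (= `KZ.PiCancellation`, item stmt-KontsevichZagierPeriods-0540;
conjecture-grade, summit-implied).** `[π]·c ∈ relations → c ∈ relations`. OPEN. -/
theorem stub_piCancellation : PiCancellation := by
  sorry

/-! ## The deciding composition -/

/-- **The line's composition**: `NormalFormPrinciple` (the crux BY NAME) from the two stubs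
through the landed transfer `normalFormPrinciple_of_leaves`.
[cite: KontsevichZagier2001, §1.2 Conjecture 1] -/
theorem NormalFormPrinciple_of : NormalFormPrinciple :=
  normalFormPrinciple_of_leaves stub_boxRigidity stub_piCancellation

end Summit.KontsevichZagierPeriods.HurwitzMicroSectors.NormalFormPrinciple.PiBox
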